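import Summits.QuantumFields.BalabanUV.Beta.GAN24.DressedLegSeamLowerBound

/-!
# `BalabanUV.Beta.GAN24.DressedCubicPushNoContraction` — binder row G-an2-4 ∕ (CONV-C), W-slot CT-W, route «WC-TL» ∕ (Q-R) «QR-LL», the (LT) row of the
# OWNER's END `WardRemainderEndThree.wLocStencil_unitS_of_layer` (p327197 ✓): **THE DRESSED CUBIC TRANSPORT DOES NOT CONTRACT IN THE END's UNITS** —
# on the unit SEAM-BOND LETTER of the composite block (ff-valued, `LocStencil` with constant `1` at every rate, supported on ONE bond crossing `∂B_{Lc^{k+1}}(0)`)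
# the scaled cubic push `(Lc^{k+1})^{3(d+1)} • push₃ T T T S` through the literal's dressed chain `T = legChain (respStepBmSeq ρ Lc) m k` has an entry
# `≥ (2(d+1))⁻³` AT EVERY DEPTH `k` (level-free, `d`-generic); hence NO layer bound of the END's (LT) shape with ratio `θ < 1` holds on the (LAY) class —
# the (LT) row is suppliable only letter by letter through cancellations (flux-free ∕ co-closed content), never from profile rows
# (row owner `b2b-balaban-gan24-p1`, gen 32; the kernel face of the mechanism behind RULING R-gan24p1-g29-1 (C) ∕ K-LL-4 (c) and ALT3-COST (F2) «block-constant
# gauges are the undamped modes of the dressed transport»; leaf-01 g69 (`g69/NOTES-g69.md`, 23:25Z) noted the general inequality `sup|L^{3(d+1)}·push₃ T T T S| ≥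
# |Γ_L(S)|∕(2(d+1))³` («ROW-WARD thrice», `Γ_L` = the triple block-gauge read) and that `Γ ≡ 0` on the literal's raw Wilson letter; THIS file types its sharp
# instance on the elementary charged letter (`Γ = ±1`), where the push factorises and ONE pigeonhole suffices — it refutes the GENERIC (LT) supply, NOT (Q-R)
# for the literal)

NOT IN PRINT; OUR BOOKKEEPING ([folklore] the entry formula `Push3.push₃_inl_inl` on a one-point letter (two `tsum_eq_single`, two `Fintype.sum_eq_single`) ⨾
leaf-01 g69's seam pigeonhole `DressedLegSeamLowerBound.exists_abs_legChain_ge_at_seam` ∕ `abs_gaugeWt_seamBond` (p344876 ✓) ⨾ `exists_pow_lt_of_lt_one`;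
generic `d`; 0 `def`, 0 cited facts, 0 `def … : Prop`, 0 sorry).  HONEST FRAMING (cell contract, verbatim): «discharging `BetaPertH` makes Bałaban's UV
stability UNCONDITIONAL — a real constructive-QFT result; it is NOT the continuum limit and NOT the Clay problem.»  HONEST DEPENDENCY (verbatim): «continuum
YM on T⁴ ⇐ BetaPertH ∧ nine spine estimates (0/9 proved); BetaPertH ⇐ (D1) ∧ (D4) ∧ CAP+tail; G-an2-4 gates asym, D1 and NE2/3/4.»

## Why
The END `wLocStencil_unitS_of_layer` asks, uniformly in the depth `k`, the LAYER BOUND (LT) `hLT`: `BiLoc ((Lc^{k+1})^{3(d+1)} • push₃ T T T S_m ν U) U U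
(K·θ^{k+1}·e^{−η‖Y−U‖₁}) (κ∕4)` with a ratio `θ < 1` (`θ = (√Lc)⁻¹` at `d = 3`), for the letter `S_m` of the (LAY) rows (`hff ∕ hS ∕ hω`: ff-valued, unit-class
profile, supported on the faces of the super-block).  The verdict of record (RULING R-gan24p1-g29-1 ∕ -g31-1) is that for the DRESSED chain this row is NOT
suppliable by any leg-generic transport estimate — «NEGATIVE-BY-COUNT» (engine E33∕E36∕E38) with leaf-01's kernel lower bound on the LEGS (PART 3 §3: the
depth-`k` chain is `≥ (Lc^{(d+1)(k+1)})⁻¹∕(2(d+1))` on every seam bond of the composite block lattice).  This file closes the LETTER-level statement in the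
kernel: take for `S` the elementary charged letter — the unit letter sitting on ONE seam bond `(0, (L−1)e₀)` of the composite block `B_L(0)`, `L = Lc^{k+1}`,
on all three indices (§1: it is ff-valued and `LocStencil S 1 δ` for every `δ` — the (LAY) profile with constant `1`; its support is a face site of the composite
block, where the END's face weight `ω` is `≥ 1`; the END's (LAY) rows are asked per depth, and so is this letter: one per `k`).  On a one-point letter the cubic
push FACTORISES into three single entries of the leg (§2), so at the coarse triple `(α, y′)³` given by leaf-01's pigeonhole the scaled push is
`L^{3(d+1)}·(T α y′ 0 u₀)³` with `|T α y′ 0 u₀| ≥ L^{−(d+1)}∕(2(d+1))`: **`≥ (2(d+1))⁻³`, the SAME number at every depth** (§3) — the END's unit `L^{d+1}` per leg is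
exactly the power the coarse Ward law forces at the seams, so nothing is left to contract.  §4: therefore, for every `θ ∈ [0,1)`, every constant `K`, every
`η ≥ 0`, rate `r` and label `Y`, the (LT) shape FAILS at some depth (`θ^{k+1} → 0`).  WHAT THIS DECIDES: the (LT) row cannot be discharged from the (LAY) rows
for the dressed chain at ANY `d` and ANY ratio `θ < 1` (not only leaf-12's envelopes: no estimate that sees the letter through a profile can); a supplier of
`hLT` must use the letter's CANCELLATIONS — its flux-free ∕ co-closed content (`LayerTransportFluxFreeSocket`, `…LiteralSocketCoClosed`, K-LL-4 (a)) — which is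
the (Q-R)^{cc} re-cut of `WardRemainderEndThreeCoDress` with the charged remainder displayed as (DL).  WHAT IT DOES NOT DECIDE: (Q-R) ∕ `hLT` for the LITERAL's
letters (their triple block-gauge read vanishes on the raw Wilson letter, leaf-01 g69; the literal's charge sits in the boundary-flux tower K-LL-4′, priced
NEGATIVE-BY-COUNT, not refuted here); nothing of (DIV) ∕ (DL) ∕ «T2Shape».

## What (generic `d`; `[NeZero Lc]`; in-block root `toSite rr`; `T := legChain (respStepBmSeq (toSite rr) Lc) m k`, any base level `m`)
* §1 THE SEAM-BOND LETTER's class: a letter family `S` with `S κ u x z a b = [κ = κ₀ ∧ u = u₀ ∧ x = u₀ ∧ z = u₀ ∧ a = inl κ₀ ∧ b = inl κ₀]` (hypothesis `hS`;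
  no `def`) is ff-valued (`isFF_of_pointLetter`) and `LocStencil S 1 δ` for every `δ` (`locStencil_of_pointLetter`) — the (LAY) profile rows with constant `1`.
* §2 `vertexW_pointLetter_inl_inl`, **`push₃_pointLetter_inl_inl`**: for ANY leg families `l r w`, `push₃ l r w S κ′ u′ x′ z′ (inl α) (inl β) = l α x′ κ₀ u₀ ·
  w κ′ u′ κ₀ u₀ · r β z′ κ₀ u₀` — the cubic push of a one-point letter is the product of three leg entries.
* §3 **`exists_abs_scaledPush₃_pointLetter_ge_of_seam`**: for ANY composite block `y` and ANY bond `(κ₀, u₀)` crossing `∂B_{Lc^{k+1}}(y)`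
  (`|gaugeWt (Lc^{k+1}) y κ₀ u₀| = 1`) and the one-point letter there: `∃ α, y′ ∈ {y, y − e_α}`, `(2(d+1))⁻¹ ^ 3 ≤ |(Lc^{k+1})^{3(d+1)} · push₃ T T T S α y′ y′ y′
  (inl α) (inl α)|` — EVERY `m`, EVERY `k`, EVERY seam; **`exists_abs_scaledPush₃_seamLetter_ge`**: the instance at leaf-01's seam bond `(0, (Lc^{k+1}−1)•e₀)`
  of the block `0`.
* §4 **`not_layerBound_seamLetter`**: for `0 ≤ θ < 1`, any `K`, `η ≥ 0`, `r`, `Y` and any depth-indexed family `S k` of seam-bond letters (§3's, one per `k`):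
  `¬ ∀ k ν U, BiLoc ((Lc^{k+1})^{3(d+1)} • push₃ T_k T_k T_k (S k) ν U) U U (K·θ^{k+1}·e^{−η‖Y−U‖₁}) r` — the END's `hLT` shape is FALSE on the (LAY) class.
Identities + one pigeonhole + `θ^k → 0` only; NO size of any literal letter asserted; decides nothing about (Q-R) ∕ (DIV) ∕ (DL) ∕ K-LL-4′ for the literal as
binders; NEVER «G-an2-4 closed» as (CONV-C); NOT D1, NOT `BetaPertH`, NOT continuum, NOT Clay; not in print — our bookkeeping.  2026-08-23; no existing file touched.
-/

noncomputable section

open Finset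
open scoped BigOperators
open Literature.MathematicalPhysics.QuantumFieldTheory
open Literature.MathematicalPhysics.QuantumFieldTheory.Balaban1983to89
open Literature.MathematicalPhysics.QuantumFieldTheory.Balaban1983to89.Beta
open B12Sec2to5 (l1 l1_nonneg)
open ExpKernelCalculus (MKer BiLoc)
open AffineAveraging (box toSite)
open OneStepResolventKernel (Fib LocStencil)
open Summit.QuantumFields.BalabanUV.Beta.KernelWardRelative (gaugeWt)
open Summit.QuantumFields.BalabanUV.Beta.GAN24.Push4 (vertexW vertexW_apply IsFF)
open Summit.QuantumFields.BalabanUV.Beta.GAN24.Push4Iter (legChain)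
open Summit.QuantumFields.BalabanUV.Beta.GAN24.Push3 (push₃ push₃_inl_inl push₃_inr_left push₃_inr_right)
open Summit.QuantumFields.BalabanUV.Beta.GAN24.RespStepBmDecompExact (respStepBmSeq)
open Summit.QuantumFields.BalabanUV.Beta.GAN24.DressedLegSeamLowerBound (exists_abs_legChain_ge_at_seam abs_gaugeWt_seamBond)

namespace Summit.QuantumFields.BalabanUV.Beta.GAN24.DressedCubicPushNoContraction

variable {d : ℕ}

/-! ## §1 The one-point (seam-bond) letter is in the (LAY) class with constant `1` -/
section PointLetter
variable {S : Fin (d + 1) → (Fin (d + 1) → ℤ) → MKer (d + 1) (Fib d)} {κ₀ : Fin (d + 1)} {u₀ : Fin (d + 1) → ℤ}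

/-- [folklore] **THE ONE-POINT LETTER IS ff-VALUED**: a letter family equal to the indicator of the single entry `(κ₀, u₀; u₀, u₀; inl κ₀, inl κ₀)` has no
multiplier rows or columns. -/
theorem isFF_of_pointLetter
    (hS : ∀ κ u x z a b, S κ u x z a b = if κ = κ₀ ∧ u = u₀ ∧ x = u₀ ∧ z = u₀ ∧ a = Sum.inl κ₀ ∧ b = Sum.inl κ₀ then 1 else 0)
    (κ : Fin (d + 1)) (u : Fin (d + 1) → ℤ) : IsFF (S κ u) := by
  refine ⟨fun x z μ b => ?_, fun x z a ν => ?_⟩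
  · rw [hS]; simp
  · rw [hS]; simp

/-- [folklore] **THE ONE-POINT LETTER IS A UNIT-CLASS LOCAL STENCIL FAMILY AT EVERY RATE**: `LocStencil S 1 δ` for every `δ` (its only nonzero entry sits at
`x = z = u`, where the profile weight is `e⁰ = 1`) — it lies INSIDE the END's (LAY) class with the level-free constant `Cs = 1`. -/
theorem locStencil_of_pointLetter
    (hS : ∀ κ u x z a b, S κ u x z a b = if κ = κ₀ ∧ u = u₀ ∧ x = u₀ ∧ z = u₀ ∧ a = Sum.inl κ₀ ∧ b = Sum.inl κ₀ then 1 else 0)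
    (δ : ℝ) : LocStencil S 1 δ := by
  intro κ u x z a b
  rw [hS]
  split_ifs with h
  · obtain ⟨-, hu, hx, hz, -, -⟩ := h
    subst hu; subst hx; subst hz
    simp [l1]
  · rw [abs_zero]; positivity

/-! ## §2 The cubic push of a one-point letter factorises into three leg entries -/

variable (l r w : Fin (d + 1) → (Fin (d + 1) → ℤ) → Fin (d + 1) → (Fin (d + 1) → ℤ) → ℝ)

/-- [folklore] The table leg on a one-point letter: `vertexW w S κ′ u′ x z (inl κ₁) (inl κ₂) = [x = u₀ ∧ z = u₀ ∧ κ₁ = κ₀ ∧ κ₂ = κ₀] · w κ′ u′ κ₀ u₀`. -/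
theorem vertexW_pointLetter_inl_inl
    (hS : ∀ κ u x z a b, S κ u x z a b = if κ = κ₀ ∧ u = u₀ ∧ x = u₀ ∧ z = u₀ ∧ a = Sum.inl κ₀ ∧ b = Sum.inl κ₀ then 1 else 0)
    (κ' : Fin (d + 1)) (u' x z : Fin (d + 1) → ℤ) (κ₁ κ₂ : Fin (d + 1)) :
    vertexW w S κ' u' x z (Sum.inl κ₁) (Sum.inl κ₂)
      = if x = u₀ ∧ z = u₀ ∧ κ₁ = κ₀ ∧ κ₂ = κ₀ then w κ' u' κ₀ u₀ else 0 := by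
  rw [vertexW_apply]
  have h1 : ∀ κ, ∑' u, w κ' u' κ u * S κ u x z (Sum.inl κ₁) (Sum.inl κ₂)
      = w κ' u' κ u₀ * S κ u₀ x z (Sum.inl κ₁) (Sum.inl κ₂) := by
    intro κ
    refine tsum_eq_single u₀ (fun u hu => ?_)
    rw [hS, if_neg (fun h => hu h.2.1), mul_zero]
  simp_rw [h1]
  rw [Fintype.sum_eq_single κ₀ (fun κ hκ => by rw [hS, if_neg (fun h => hκ h.1), mul_zero]), hS]
  simp only [Sum.inl.injEq, true_and]
  split_ifs <;> simp

/-- [folklore] **THE CUBIC PUSH OF A ONE-POINT LETTER IS THE PRODUCT OF THREE LEG ENTRIES**: for ANY leg families `l r w`,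
`push₃ l r w S κ′ u′ x′ z′ (inl α) (inl β) = l α x′ κ₀ u₀ · w κ′ u′ κ₀ u₀ · r β z′ κ₀ u₀` (the entry formula `Push3.push₃_inl_inl`, all sums one-point). -/
theorem push₃_pointLetter_inl_inl
    (hS : ∀ κ u x z a b, S κ u x z a b = if κ = κ₀ ∧ u = u₀ ∧ x = u₀ ∧ z = u₀ ∧ a = Sum.inl κ₀ ∧ b = Sum.inl κ₀ then 1 else 0)
    (κ' : Fin (d + 1)) (u' x' z' : Fin (d + 1) → ℤ) (α β : Fin (d + 1)) :
    push₃ l r w S κ' u' x' z' (Sum.inl α) (Sum.inl β) = l α x' κ₀ u₀ * w κ' u' κ₀ u₀ * r β z' κ₀ u₀ := by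
  rw [push₃_inl_inl]
  simp_rw [vertexW_pointLetter_inl_inl w hS]
  -- the inner (left-leg) sum is one-point in `(x, κ₁)`
  have hin : ∀ z κ₂, (∑' x, ∑ κ₁, l α x' κ₁ x * (if x = u₀ ∧ z = u₀ ∧ κ₁ = κ₀ ∧ κ₂ = κ₀ then w κ' u' κ₀ u₀ else 0))
      = if z = u₀ ∧ κ₂ = κ₀ then l α x' κ₀ u₀ * w κ' u' κ₀ u₀ else 0 := by
    intro z κ₂
    rw [tsum_eq_single u₀ (fun x hx => by
      refine Finset.sum_eq_zero fun κ₁ _ => ?_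
      rw [if_neg (fun h => hx h.1), mul_zero])]
    rw [Fintype.sum_eq_single κ₀ (fun κ₁ hκ => by rw [if_neg (fun h => hκ h.2.2.1), mul_zero])]
    simp only [true_and]
    split_ifs <;> simp
  simp_rw [hin]
  -- the outer (right-leg) sum is one-point in `(z, κ₂)`
  rw [tsum_eq_single u₀ (fun z hz => by
    refine Finset.sum_eq_zero fun κ₂ _ => ?_
    rw [if_neg (fun h => hz h.1), zero_mul])]
  rw [Fintype.sum_eq_single κ₀ (fun κ₂ hκ => by rw [if_neg (fun h => hκ h.2), zero_mul])]
  simp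

end PointLetter

/-! ## §3 The scaled dressed cubic push of the seam-bond letter is `≥ (2(d+1))⁻³` at every depth -/
section Dressed
variable {Lc : ℕ} [NeZero Lc] {rr : Fin (d + 1) → ℕ}

/-- NOT IN PRINT; OUR BOOKKEEPING (§2 ⨾ leaf-01 g69's `exists_abs_legChain_ge_at_seam`).  **THE DRESSED CUBIC TRANSPORT DOES NOT CONTRACT IN THE END's UNITS —
ANY SEAM BOND.**  For every in-block root, base level `m`, depth `k`, composite block `y` and bond `(κ₀, u₀)` crossing `∂B_L(y)` (`|gaugeWt L y κ₀ u₀| = 1`,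
`L = Lc^{k+1}`), with `S` the one-point letter at `(κ₀, u₀)` (§1: ff-valued, `LocStencil S 1 δ`), there are a direction `α` and a coarse site `y′ ∈ {y, y − e_α}`
with `(2(d+1))⁻¹ ^ 3 ≤ |L^{3(d+1)} · push₃ T T T S α y′ y′ y′ (inl α) (inl α)|`, `T = legChain (respStepBmSeq (toSite rr) Lc) m k` — the scaled push is the cube
of `L^{d+1}·T α y′ κ₀ u₀`, which the coarse Ward law pins at `≥ (2(d+1))⁻¹` on the seam: THE SAME NUMBER AT EVERY DEPTH, ON EVERY SEAM. -/
theorem exists_abs_scaledPush₃_pointLetter_ge_of_seam (hrr : rr ∈ box (d + 1) Lc) (m k : ℕ)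
    {S : Fin (d + 1) → (Fin (d + 1) → ℤ) → MKer (d + 1) (Fib d)} {κ₀ : Fin (d + 1)} {u₀ y : Fin (d + 1) → ℤ}
    (hS : ∀ κ u x z a b, S κ u x z a b = if κ = κ₀ ∧ u = u₀ ∧ x = u₀ ∧ z = u₀ ∧ a = Sum.inl κ₀ ∧ b = Sum.inl κ₀ then 1 else 0)
    (hseam : |gaugeWt (Lc ^ (k + 1)) y κ₀ u₀| = 1) :
    ∃ (α : Fin (d + 1)) (y' : Fin (d + 1) → ℤ), (y' = y ∨ y' = y - AffineAveraging.unitVec α) ∧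
      (2 * ((d : ℝ) + 1))⁻¹ ^ 3 ≤ |((((Lc ^ (k + 1) : ℕ) : ℝ)) ^ (3 * (d + 1)))
        * push₃ (legChain (respStepBmSeq (toSite rr) Lc) m k) (legChain (respStepBmSeq (toSite rr) Lc) m k)
            (legChain (respStepBmSeq (toSite rr) Lc) m k) S α y' y' y' (Sum.inl α) (Sum.inl α)| := by
  obtain ⟨α, y', hy', hle⟩ := exists_abs_legChain_ge_at_seam hrr m k hseam
  refine ⟨α, y', hy', ?_⟩
  set t : ℝ := legChain (respStepBmSeq (toSite rr) Lc) m k α y' κ₀ u₀ with ht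
  rw [push₃_pointLetter_inl_inl _ _ _ hS]
  have hLc : (0 : ℝ) < (Lc : ℝ) := by exact_mod_cast Nat.pos_of_ne_zero (NeZero.ne Lc)
  set c : ℝ := ((Lc : ℝ) ^ ((d + 1) * (k + 1)))⁻¹ with hc
  have hc0 : 0 < c := by positivity
  have hd : (0 : ℝ) < 2 * ((d : ℝ) + 1) := by positivity
  -- the END's unit is `c⁻³`
  have hunit : ((((Lc ^ (k + 1) : ℕ) : ℝ)) ^ (3 * (d + 1))) = (c ^ 3)⁻¹ := by
    rw [hc, inv_pow, inv_inv, ← pow_mul]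
    push_cast
    rw [← pow_mul]
    congr 1
    ring
  -- `|t| ≥ c ∕ (2(d+1))`
  have ht' : (2 * ((d : ℝ) + 1))⁻¹ * c ≤ |t| := by
    rw [inv_mul_le_iff₀ hd]
    exact hle
  have ht0 : 0 ≤ (2 * ((d : ℝ) + 1))⁻¹ * c := by positivity
  have hcube : ((2 * ((d : ℝ) + 1))⁻¹ * c) ^ 3 ≤ |t| ^ 3 := pow_le_pow_left₀ ht0 ht' 3
  rw [hunit, abs_mul, abs_inv, abs_of_pos (pow_pos hc0 3), show t * t * t = t ^ 3 by ring, abs_pow]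
  have hc3 : 0 < c ^ 3 := pow_pos hc0 3
  rw [le_inv_mul_iff₀ hc3]
  calc c ^ 3 * ((2 * ((d : ℝ) + 1))⁻¹ ^ 3) = ((2 * ((d : ℝ) + 1))⁻¹ * c) ^ 3 := by ring
    _ ≤ |t| ^ 3 := hcube

/-- NOT IN PRINT; OUR BOOKKEEPING (the previous theorem at leaf-01's seam bond `abs_gaugeWt_seamBond` of the composite block `0`: `κ₀ = 0`, `u₀ = (Lc^{k+1}−1)•e₀`,
`y = 0`).  **THE DRESSED CUBIC TRANSPORT DOES NOT CONTRACT IN THE END's UNITS** — the instance §4 iterates over the depth: for every in-block root, `m`, `k`,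
with `S` the one-point letter at the bond `(0, (Lc^{k+1}−1)•e₀)`: `∃ α, y′ ∈ {0, −e_α}`, `(2(d+1))⁻¹ ^ 3 ≤ |(Lc^{k+1})^{3(d+1)} · push₃ T T T S α y′ y′ y′ (inl α) (inl α)|`. -/
theorem exists_abs_scaledPush₃_seamLetter_ge (hrr : rr ∈ box (d + 1) Lc) (m k : ℕ)
    {S : Fin (d + 1) → (Fin (d + 1) → ℤ) → MKer (d + 1) (Fib d)}
    (hS : ∀ κ u x z a b, S κ u x z a b =
      if κ = 0 ∧ u = (fun i => if i = 0 then ((Lc ^ (k + 1) : ℕ) : ℤ) - 1 else 0) ∧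
        x = (fun i => if i = 0 then ((Lc ^ (k + 1) : ℕ) : ℤ) - 1 else 0) ∧ z = (fun i => if i = 0 then ((Lc ^ (k + 1) : ℕ) : ℤ) - 1 else 0) ∧
        a = Sum.inl 0 ∧ b = Sum.inl 0 then 1 else 0) :
    ∃ (α : Fin (d + 1)) (y' : Fin (d + 1) → ℤ), (y' = 0 ∨ y' = 0 - AffineAveraging.unitVec α) ∧
      (2 * ((d : ℝ) + 1))⁻¹ ^ 3 ≤ |((((Lc ^ (k + 1) : ℕ) : ℝ)) ^ (3 * (d + 1)))
        * push₃ (legChain (respStepBmSeq (toSite rr) Lc) m k) (legChain (respStepBmSeq (toSite rr) Lc) m k)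
            (legChain (respStepBmSeq (toSite rr) Lc) m k) S α y' y' y' (Sum.inl α) (Sum.inl α)| :=
  exists_abs_scaledPush₃_pointLetter_ge_of_seam hrr m k hS
    (abs_gaugeWt_seamBond (d := d) (Lc ^ (k + 1)) (Nat.one_le_iff_ne_zero.2 (pow_ne_zero _ (NeZero.ne Lc))))

/-! ## §4 Hence NO layer bound of the END's (LT) shape with ratio `θ < 1` holds on the (LAY) class -/

/-- NOT IN PRINT; OUR BOOKKEEPING (§3 ⨾ `exists_pow_lt_of_lt_one`).  **THE END's LAYER BOUND `hLT` IS FALSE ON THE (LAY) CLASS FOR THE DRESSED CHAIN, AT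
EVERY RATIO `θ < 1`**: for `0 ≤ θ < 1`, any constant `K`, any `η ≥ 0`, any rate `r`, any label `Y`, any base level `m`, and the depth-indexed family of
seam-bond letters `S k` (§3's letter at blocking `Lc^{k+1}`, unit (LAY) class by §1), it is NOT the case that for all depths `k` and coarse slots `(ν, U)`
`BiLoc ((Lc^{k+1})^{3(d+1)} • push₃ T_k T_k T_k (S k) ν U) U U (K·θ^{k+1}·e^{−η‖Y−U‖₁}) r` — the shape of `WardRemainderEndThree.wLocStencil_unitS_of_layer`'s
`hLT` (there `θ = (√Lc)⁻¹`, `η = min(κ∕2, δ∕2)`, `r = κ∕4`).  So the (LT) row is not a consequence of the (LAY) rows for the literal's dressed chain, at any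
`d`: whoever supplies it must use the letter's cancellations (flux-free ∕ co-closed content).  Decides nothing about the LITERAL's letters. -/
theorem not_layerBound_seamLetter (hrr : rr ∈ box (d + 1) Lc) (m : ℕ) {θ K η r : ℝ} (hθ0 : 0 ≤ θ) (hθ1 : θ < 1) (hη : 0 ≤ η)
    (Y : Fin (d + 1) → ℤ) {S : ℕ → Fin (d + 1) → (Fin (d + 1) → ℤ) → MKer (d + 1) (Fib d)}
    (hS : ∀ k κ u x z a b, S k κ u x z a b =
      if κ = 0 ∧ u = (fun i => if i = 0 then ((Lc ^ (k + 1) : ℕ) : ℤ) - 1 else 0) ∧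
        x = (fun i => if i = 0 then ((Lc ^ (k + 1) : ℕ) : ℤ) - 1 else 0) ∧ z = (fun i => if i = 0 then ((Lc ^ (k + 1) : ℕ) : ℤ) - 1 else 0) ∧
        a = Sum.inl 0 ∧ b = Sum.inl 0 then 1 else 0) :
    ¬ ∀ (k : ℕ) (ν : Fin (d + 1)) (U : Fin (d + 1) → ℤ),
        BiLoc ((((Lc ^ (k + 1) : ℕ) : ℝ) ^ (3 * (d + 1))) •
          push₃ (legChain (respStepBmSeq (toSite rr) Lc) m k) (legChain (respStepBmSeq (toSite rr) Lc) m k)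
            (legChain (respStepBmSeq (toSite rr) Lc) m k) (S k) ν U) U U
          (K * θ ^ (k + 1) * Real.exp (-η * l1 (Y - U))) r := by
  intro h
  have hd : (0 : ℝ) < (2 * ((d : ℝ) + 1))⁻¹ ^ 3 := by positivity
  -- a depth at which `(|K|+1)·θ^k` is below the level-free lower bound
  obtain ⟨n, hn⟩ := exists_pow_lt_of_lt_one (show (0 : ℝ) < (2 * ((d : ℝ) + 1))⁻¹ ^ 3 / (|K| + 1) by positivity) hθ1
  obtain ⟨α, y', -, hge⟩ := exists_abs_scaledPush₃_seamLetter_ge hrr m n (hS n)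
  have hB := h n α y' y' y' (Sum.inl α) (Sum.inl α)
  simp only [Pi.smul_apply, smul_eq_mul, sub_self] at hB
  have hl0 : l1 (0 : Fin (d + 1) → ℤ) = 0 := by simp [l1]
  rw [hl0, add_zero, mul_zero, Real.exp_zero, mul_one] at hB
  -- `K·θ^{n+1}·e^{−η‖Y−y′‖} ≤ (|K|+1)·θ^n`
  have he : Real.exp (-η * l1 (Y - y')) ≤ 1 := Real.exp_le_one_iff.2 (by nlinarith [l1_nonneg (Y - y')])
  have hθn : θ ^ (n + 1) ≤ θ ^ n := pow_le_pow_of_le_one hθ0 hθ1.le (Nat.le_succ n)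
  have hK1 : (0 : ℝ) < |K| + 1 := by positivity
  have hup : K * θ ^ (n + 1) * Real.exp (-η * l1 (Y - y')) ≤ (|K| + 1) * θ ^ n := by
    have h1 : K * θ ^ (n + 1) * Real.exp (-η * l1 (Y - y')) ≤ |K| * θ ^ (n + 1) := by
      calc K * θ ^ (n + 1) * Real.exp (-η * l1 (Y - y'))
          ≤ |K * θ ^ (n + 1) * Real.exp (-η * l1 (Y - y'))| := le_abs_self _
        _ = |K| * θ ^ (n + 1) * Real.exp (-η * l1 (Y - y')) := by
          rw [abs_mul, abs_mul, abs_of_nonneg (pow_nonneg hθ0 _), abs_of_nonneg (Real.exp_pos _).le]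
        _ ≤ |K| * θ ^ (n + 1) * 1 := mul_le_mul_of_nonneg_left he (by positivity)
        _ = |K| * θ ^ (n + 1) := mul_one _
    calc K * θ ^ (n + 1) * Real.exp (-η * l1 (Y - y')) ≤ |K| * θ ^ (n + 1) := h1
      _ ≤ |K| * θ ^ n := mul_le_mul_of_nonneg_left hθn (abs_nonneg K)
      _ ≤ (|K| + 1) * θ ^ n := by nlinarith [pow_nonneg hθ0 n]
  have hlt : (|K| + 1) * θ ^ n < (2 * ((d : ℝ) + 1))⁻¹ ^ 3 := by
    rw [lt_div_iff₀ hK1] at hn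
    linarith [mul_comm (θ ^ n) (|K| + 1)]
  linarith [hge.trans hB]

end Dressed
end Summit.QuantumFields.BalabanUV.Beta.GAN24.DressedCubicPushNoContraction
end
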